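import Literature.MathematicalPhysics.QuantumLattice.KomaPiFluxDoubleCommutatorSumRule
import Literature.MathematicalPhysics.QuantumLattice.KomaPiFluxEtaRotationSymmetry
import HarnessLib

/-!
# The Kennedy–Lieb–Shastry inequality for the `π`-flux BCS model (Koma 2022, (6.17)–(6.24), (6.34))

T. Koma, *Nambu–Goldstone modes for superconducting lattice fermions*, arXiv:2201.13135 (2022)
[Koma2022], §6: the long-range order bound (6.34),
`E₁ ≤ δ(β) + I_d√(|κ|/g) + I_d√(E₁/2) + (m_LRO)²`, obtained by inserting the infrared bound
(6.16), the sum rule (6.20) and the double-commutator estimate (6.33) into the Kennedy–Lieb–Shastry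
scheme (6.17), (6.21)–(6.24) (Cauchy–Schwarz on the dual torus, (6.22)).

This file PROVES the finite-volume inequality in the Lieb frame of this series:

* `KomaPiFlux.koma_kls_abstract` — the real-analysis core: from `0 ≤ G_q ≤ b_q + ½√(β b_q c_q)`
  (`q ≠ 0`, `b_q = |Λ|/(βgE_q)`), `c_q ≥ 0`, `Σ_q c_q ≤ |Λ| S` and the split sum rule
  `Σ_{q≠0} G_q C_q + M₀ C_0 = |Λ| N₁` one gets
  `|Λ| N₁ ≤ M₀ (d+1) + (|Λ|/βg) Σ_{q≠0}{C_q}₊/E_q + ½ [ (|Λ|/g) Σ_{q≠0}{C_q}₊²/E_q ]^{1/2} [|Λ| S]^{1/2}`;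
* `KomaPiFlux.koma_kls` — the model statement for `H₀ = H(κ,U,g,0,0)` (`κ ≥ 0`, `g > 0`, `β > 0`,
  `L ≥ 4` even): with `N₁ = Σ_i Σ_x Re⟨Γ¹_xΓ¹_{x+e_i}⟩` (total nearest-neighbour `η` correlation,
  `= (d+1)|Λ| E₁`), `M₀ = Σ_{x,y} Re⟨Γ¹_xΓ¹_y⟩ = |Λ|² m²`,
  `|Λ| N₁ ≤ (d+1) M₀ + (|Λ|/βg)·Σ_{q≠0}{C_q}₊/E_q + ½[(|Λ|/g)Σ_{q≠0}{C_q}₊²/E_q]^{1/2}[|Λ|(8(d+1)κ|Λ| + 4gN₁)]^{1/2}`,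
  i.e. after division by `(d+1)|Λ|²`: `E₁ ≤ m² + δ_Λ(β) + ½ I_{d+1,Λ} √(8κ/g + 4E₁)` — Koma's (6.34) with
  the constants of this series' infrared bound (`1/(βgE_p)`, twice (6.11)).

Inputs: `gibbs_modes_le` ((6.16)), `modes_weightedSumRule`/`modes_sum_split` ((6.17)–(6.20)),
`doubleComm_modes_sumRule`/`sum_dcKernel_diag_eq`/`sum_re_gibbsState_doubleComm_hopping_le` ((6.25)–(6.33))
and the rotation symmetry `⟨Γ²Γ²⟩ = ⟨Γ¹Γ¹⟩` ((6.31)). No named fact.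

## References

* [Koma2022] T. Koma, arXiv:2201.13135, (6.16)–(6.24), (6.31)–(6.34).
* [KLS1988PRL] T. Kennedy, E. H. Lieb, B. S. Shastry, Phys. Rev. Lett. 61 (1988) 2582, eqs. (5)–(7).
-/

noncomputable section

namespace Literature.MathematicalPhysics.QuantumLattice

open Matrix Finset HubbardWave0 PairHopRP FermionTorus LiebCutRP
open Literature.Probability.LatticeModels
open scoped ComplexOrder

namespace KomaPiFlux

attribute [local instance] LiebCutRP.decEqTorus

variable {d L : ℕ} [NeZero L]

/-! ### The real-analysis core: (6.17), (6.21)–(6.23) -/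

/-- **Koma's KLS step, abstract form.** On the dual torus of side `L` let `G, c ≥ 0` (structure
factor and double commutators of the modes `q ≠ 0`), `b_q = Λ/(βgE_q)`, and suppose
(IR) `G_q ≤ b_q + ½√(β b_q c_q)` for `q ≠ 0`, (DC) `Σ_q c_q ≤ Λ·S`, (SR) `Σ_{q≠0} G_q C_q + M₀ C_0 = Λ·N₁`
(`C_q = Σ_i cos q_i`). Then
`Λ N₁ ≤ M₀ (d+1) + (Λ/(βg)) Σ_{q≠0} {C_q}₊/E_q + ½ √((Λ/g) Σ_{q≠0} {C_q}₊²/E_q) · √(Λ S)`.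
[cite: Koma2022, (6.17), (6.21)–(6.23)] [cite: KLS1988PRL, eqs. (5)–(7)] -/
theorem koma_kls_abstract (G c : TorusSite (d + 1) L → ℝ) {β g Λ S N₁ M₀ : ℝ} (hβ : 0 < β) (hg : 0 < g)
    (hΛ : 0 ≤ Λ)
    (hG : ∀ q : TorusSite (d + 1) L, q ≠ 0 → 0 ≤ G q)
    (hc : ∀ q : TorusSite (d + 1) L, 0 ≤ c q)
    (hIR : ∀ q : TorusSite (d + 1) L, q ≠ 0 →
      G q ≤ Λ / (β * g * dispersion (latticeMomentum L q)) +
        1 / 2 * Real.sqrt (β * (Λ / (β * g * dispersion (latticeMomentum L q))) * c q))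
    (hDC : ∑ q : TorusSite (d + 1) L, c q ≤ Λ * S)
    (hSR : ∑ q ∈ (univ : Finset (TorusSite (d + 1) L)).erase 0, G q * torusCosSum L q +
      M₀ * torusCosSum L (0 : TorusSite (d + 1) L) = Λ * N₁) :
    Λ * N₁ ≤ M₀ * (d + 1) +
      Λ / (β * g) * ∑ q ∈ (univ : Finset (TorusSite (d + 1) L)).erase 0,
        max (torusCosSum L q) 0 / dispersion (latticeMomentum L q) +
      1 / 2 * Real.sqrt (Λ / g * ∑ q ∈ (univ : Finset (TorusSite (d + 1) L)).erase 0,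
        (max (torusCosSum L q) 0) ^ 2 / dispersion (latticeMomentum L q)) * Real.sqrt (Λ * S) := by
  set P : TorusSite (d + 1) L → ℝ := fun q => max (torusCosSum L q) 0 with hP
  set E : TorusSite (d + 1) L → ℝ := fun q => dispersion (latticeMomentum L q) with hE
  set s' := (univ : Finset (TorusSite (d + 1) L)).erase 0 with hs'
  have hEpos : ∀ q ∈ s', 0 < E q := fun q hq => dispersion_latticeMomentum_pos (Finset.mem_erase.1 hq).1
  have hPnn : ∀ q, 0 ≤ P q := fun q => le_max_right _ _
  -- Step 1: `G_q C_q ≤ G_q {C_q}₊ ≤ (b_q + ½√(β b_q c_q)) {C_q}₊`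
  have h1 : ∑ q ∈ s', G q * torusCosSum L q ≤
      ∑ q ∈ s', (Λ / (β * g * E q) * P q + 1 / 2 * (Real.sqrt (Λ / g * (P q ^ 2 / E q)) * Real.sqrt (c q))) := by
    refine Finset.sum_le_sum fun q hq => ?_
    have hq0 : q ≠ 0 := (Finset.mem_erase.1 hq).1
    have hGq := hG q hq0
    have hEq := hEpos q hq
    calc G q * torusCosSum L q ≤ G q * P q := mul_le_mul_of_nonneg_left (le_max_left _ _) hGq
      _ ≤ (Λ / (β * g * E q) + 1 / 2 * Real.sqrt (β * (Λ / (β * g * E q)) * c q)) * P q :=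
          mul_le_mul_of_nonneg_right (hIR q hq0) (hPnn q)
      _ = Λ / (β * g * E q) * P q + 1 / 2 * (Real.sqrt (β * (Λ / (β * g * E q)) * c q) * P q) := by ring
      _ = Λ / (β * g * E q) * P q + 1 / 2 * (Real.sqrt (Λ / g * (P q ^ 2 / E q)) * Real.sqrt (c q)) := by
          have hx0 : 0 ≤ β * (Λ / (β * g * E q)) * c q := by have := hc q; positivity
          have hx : 0 ≤ Λ / g * (P q ^ 2 / E q) := by positivity
          have hPs : P q = Real.sqrt (P q ^ 2) := (Real.sqrt_sq (hPnn q)).symm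
          have key : Real.sqrt (β * (Λ / (β * g * E q)) * c q) * P q =
              Real.sqrt (Λ / g * (P q ^ 2 / E q)) * Real.sqrt (c q) := by
            calc Real.sqrt (β * (Λ / (β * g * E q)) * c q) * P q
                = Real.sqrt (β * (Λ / (β * g * E q)) * c q) * Real.sqrt (P q ^ 2) := by rw [← hPs]
              _ = Real.sqrt (β * (Λ / (β * g * E q)) * c q * P q ^ 2) := (Real.sqrt_mul hx0 _).symm
              _ = Real.sqrt (Λ / g * (P q ^ 2 / E q) * c q) := by
                  congr 1
                  field_simp
              _ = Real.sqrt (Λ / g * (P q ^ 2 / E q)) * Real.sqrt (c q) := Real.sqrt_mul hx _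
          rw [key]
  -- Step 2: Cauchy–Schwarz on the square-root term, and `Σ_{q≠0} c_q ≤ Σ_q c_q ≤ Λ S`
  have h2 : ∑ q ∈ s', Real.sqrt (Λ / g * (P q ^ 2 / E q)) * Real.sqrt (c q) ≤
      Real.sqrt (Λ / g * ∑ q ∈ s', P q ^ 2 / E q) * Real.sqrt (Λ * S) := by
    have hcs := Real.sum_sqrt_mul_sqrt_le s' (f := fun q => Λ / g * (P q ^ 2 / E q)) (g := c)
      (fun q => mul_nonneg (div_nonneg hΛ hg.le) (div_nonneg (sq_nonneg _) (dispersion_nonneg _))) hc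
    refine hcs.trans ?_
    rw [← Finset.mul_sum]
    have hsub : ∑ q ∈ s', c q ≤ Λ * S :=
      (Finset.sum_le_sum_of_subset_of_nonneg (Finset.erase_subset (0 : TorusSite (d + 1) L) univ)
        fun q _ _ => hc q).trans hDC
    gcongr
  -- Step 3: assemble
  rw [torusCosSum_zero] at hSR
  have h3 : Λ * N₁ = ∑ q ∈ s', G q * torusCosSum L q + M₀ * ((d + 1 : ℕ) : ℝ) := hSR.symm
  rw [h3, Nat.cast_add, Nat.cast_one]
  have h4 : ∑ q ∈ s', G q * torusCosSum L q ≤ ∑ q ∈ s', Λ / (β * g * E q) * P q +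
      1 / 2 * (Real.sqrt (Λ / g * ∑ q ∈ s', P q ^ 2 / E q) * Real.sqrt (Λ * S)) := by
    refine h1.trans ?_
    rw [Finset.sum_add_distrib, ← Finset.mul_sum]
    exact add_le_add le_rfl (mul_le_mul_of_nonneg_left h2 (by norm_num))
  have h5 : ∑ q ∈ s', Λ / (β * g * E q) * P q = Λ / (β * g) * ∑ q ∈ s', P q / E q := by
    rw [Finset.mul_sum]
    refine Finset.sum_congr rfl fun q hq => ?_
    have hEq := hEpos q hq
    field_simp
  rw [h5] at h4
  linarith

/-! ### The model inequality (6.34), finite volume, Lieb frame -/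

omit [NeZero L] in
/-- `Re⟨A²⟩ ≥ 0` for Hermitian `A` in any Gibbs state. [cite: BratteliRobinson1997, §5.3.1] -/
private theorem re_gibbsState_sq_nonneg (β : ℝ)
    {H : Matrix (Finset (Orb (FermionTorus (d + 1) L))) (Finset (Orb (FermionTorus (d + 1) L))) ℂ} (hH : H.IsHermitian)
    {A : Matrix (Finset (Orb (FermionTorus (d + 1) L))) (Finset (Orb (FermionTorus (d + 1) L))) ℂ} (hA : A.IsHermitian) :
    0 ≤ (gibbsState β H (A * A)).re := by
  have hP : (A * A).PosSemidef := by
    nth_rw 1 [← hA.eq]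
    exact Matrix.posSemidef_conjTranspose_mul_self A
  exact (Complex.nonneg_iff.mp (gibbsState_nonneg_of_posSemidef β hH hP)).1

/-- The nearest-neighbour `Γ²` correlation sum over ordered adjacent pairs is twice the directed
nearest-neighbour `Γ¹` correlation sum (symmetry of the kernel and the `η`-rotation symmetry (6.31)).
[cite: Koma2022, (6.31)] -/
theorem sum_adj_re_gibbsState_gammaTwo_mul (h3 : 3 ≤ L) (β κ U g : ℝ) :
    ∑ x : FermionTorus (d + 1) L, ∑ y : FermionTorus (d + 1) L,
        (if (G d L).Adj x y then (gibbsState β (hamiltonian κ U g (fun (_ _ : FermionTorus (d + 1) L) => (0 : ℝ)) 0)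
          (gammaTwo x * gammaTwo y)).re else 0) =
      2 * ∑ i : Fin (d + 1), ∑ x : FermionTorus (d + 1) L,
        pairCorr β (hamiltonian κ U g (fun (_ _ : FermionTorus (d + 1) L) => (0 : ℝ)) 0) x (shift x i) := by
  set H₀ := hamiltonian κ U g (fun (_ _ : FermionTorus (d + 1) L) => (0 : ℝ)) 0 with hH₀
  have hrot : ∀ x y : FermionTorus (d + 1) L, (gibbsState β H₀ (gammaTwo x * gammaTwo y)).re = pairCorr β H₀ x y := by
    intro x y
    rw [pairCorr, hH₀]
    unfold hamiltonian
    rw [gibbsState_gammaOne_mul_eq]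
  have hsymm : ∀ x y : FermionTorus (d + 1) L, pairCorr β H₀ y x = pairCorr β H₀ x y := fun x y => pairCorr_symm β H₀ y x
  rw [← sum_shift_add_sum_shift_swap h3 (fun x y => (gibbsState β H₀ (gammaTwo x * gammaTwo y)).re)]
  simp_rw [hrot, hsymm, ← two_mul]
  rw [Finset.sum_comm, Finset.mul_sum]
  refine Finset.sum_congr rfl fun i _ => ?_
  rw [Finset.mul_sum]

/-- **Koma's long-range-order inequality (6.34), finite volume** (Lieb frame, `B = 0`, `h = 0`,
`κ ≥ 0`, `g > 0`, even `L ≥ 4`): with `H₀ = H(κ,U,g,0,0)`, `N₁ = Σ_i Σ_x Re⟨Γ¹_xΓ¹_{x+e_i}⟩_{β}`,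
`|Λ| = L^{d+1}`, `C_q = Σ_i cos q_i`, `E_q = Σ_i (1 - cos q_i)`:
`|Λ| N₁ ≤ (d+1)|Λ|² m² + (|Λ|/(βg)) Σ_{q≠0}{C_q}₊/E_q + ½ √((|Λ|/g) Σ_{q≠0}{C_q}₊²/E_q) √(|Λ|(8(d+1)κ|Λ| + 4g N₁))`.
Dividing by `(d+1)|Λ|²` this is `E₁ ≤ m² + δ_Λ(β) + ½ I_{d+1,Λ} √(8κ/g + 4E₁)` with
`E₁ = N₁/((d+1)|Λ|)`, `δ_Λ(β) = ((d+1)βg|Λ|)⁻¹Σ_{q≠0}{C_q}₊/E_q`, `I² = ((d+1)|Λ|)⁻¹Σ_{q≠0}{C_q}₊²/E_q`.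
[cite: Koma2022, (6.17)–(6.24), (6.33)–(6.34)] -/
theorem koma_kls (hL : Even L) (h4 : 4 ≤ L) {β : ℝ} (hβ : 0 < β) {κ : ℝ} (hκ : 0 ≤ κ) (U : ℝ) {g : ℝ}
    (hg : 0 < g) :
    (L : ℝ) ^ (d + 1) * ∑ i : Fin (d + 1), ∑ x : FermionTorus (d + 1) L,
        pairCorr β (hamiltonian κ U g (fun (_ _ : FermionTorus (d + 1) L) => (0 : ℝ)) 0) x (shift x i) ≤
      (Fintype.card (FermionTorus (d + 1) L) : ℝ) ^ 2 *
          lroSq β (hamiltonian κ U g (fun (_ _ : FermionTorus (d + 1) L) => (0 : ℝ)) 0) * (d + 1) +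
        (L : ℝ) ^ (d + 1) / (β * g) * ∑ q ∈ (univ : Finset (TorusSite (d + 1) L)).erase 0,
          max (torusCosSum L q) 0 / dispersion (latticeMomentum L q) +
        1 / 2 * Real.sqrt ((L : ℝ) ^ (d + 1) / g * ∑ q ∈ (univ : Finset (TorusSite (d + 1) L)).erase 0,
          (max (torusCosSum L q) 0) ^ 2 / dispersion (latticeMomentum L q)) *
          Real.sqrt ((L : ℝ) ^ (d + 1) * (8 * (d + 1) * κ * (L : ℝ) ^ (d + 1) +
            4 * g * ∑ i : Fin (d + 1), ∑ x : FermionTorus (d + 1) L,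
              pairCorr β (hamiltonian κ U g (fun (_ _ : FermionTorus (d + 1) L) => (0 : ℝ)) 0) x (shift x i))) := by
  have h3 : 3 ≤ L := by omega
  set H₀ := hamiltonian κ U g (fun (_ _ : FermionTorus (d + 1) L) => (0 : ℝ)) 0 with hH₀
  have hH : H₀.IsHermitian := hamiltonian_isHermitian (G d L) (piFluxAmpl κ) (piFluxAmpl_herm κ) U g _ 0
  set N₁ := ∑ i : Fin (d + 1), ∑ x : FermionTorus (d + 1) L, pairCorr β H₀ x (shift x i) with hN₁
  -- the data of the abstract step
  set Gq : TorusSite (d + 1) L → ℝ := fun q =>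
    (gibbsState β H₀ (gammaOneMode (cosWave q) * gammaOneMode (cosWave q))).re +
      (gibbsState β H₀ (gammaOneMode (sinWave q) * gammaOneMode (sinWave q))).re with hGq
  set cq : TorusSite (d + 1) L → ℝ := fun q =>
    doubleComm β H₀ (gammaOneMode (cosWave q)) + doubleComm β H₀ (gammaOneMode (sinWave q)) with hcq
  have hG : ∀ q : TorusSite (d + 1) L, q ≠ 0 → 0 ≤ Gq q := fun q _ =>
    add_nonneg (re_gibbsState_sq_nonneg β hH (gammaOneMode_isHermitian _))
      (re_gibbsState_sq_nonneg β hH (gammaOneMode_isHermitian _))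
  have hc : ∀ q : TorusSite (d + 1) L, 0 ≤ cq q := fun q =>
    add_nonneg (doubleComm_nonneg hβ.le κ U g _ 0 (gammaOneMode_isHermitian _))
      (doubleComm_nonneg hβ.le κ U g _ 0 (gammaOneMode_isHermitian _))
  have hIR : ∀ q : TorusSite (d + 1) L, q ≠ 0 →
      Gq q ≤ (L : ℝ) ^ (d + 1) / (β * g * dispersion (latticeMomentum L q)) +
        1 / 2 * Real.sqrt (β * ((L : ℝ) ^ (d + 1) / (β * g * dispersion (latticeMomentum L q))) * cq q) :=
    fun q hq => gibbs_modes_le hL h4 hβ hκ U hg 0 (dispersion_latticeMomentum_pos hq)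
  -- (DC): `Σ_q c_q ≤ |Λ| (8(d+1)κ|Λ| + 4g N₁)`
  have hDC : ∑ q : TorusSite (d + 1) L, cq q ≤ (L : ℝ) ^ (d + 1) * (8 * (d + 1) * κ * (L : ℝ) ^ (d + 1) + 4 * g * N₁) := by
    have hsum := doubleComm_modes_sumRule β H₀
    simp only [hcq]
    rw [hsum]
    refine mul_le_mul_of_nonneg_left ?_ (by positivity)
    unfold dcKernel
    rw [hH₀, sum_dcKernel_diag_eq, mul_zero, zero_mul, add_zero, sum_adj_re_gibbsState_gammaTwo_mul h3, ← hH₀]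
    have hK := sum_re_gibbsState_doubleComm_hopping_le (d := d) h3 hκ β hH
    nlinarith [hK, hg]
  -- (SR): the weighted sum rule summed over the directions, split at `q = 0`
  have hSR : ∑ q ∈ (univ : Finset (TorusSite (d + 1) L)).erase 0, Gq q * torusCosSum L q +
      (Fintype.card (FermionTorus (d + 1) L) : ℝ) ^ 2 * lroSq β H₀ * torusCosSum L (0 : TorusSite (d + 1) L) =
      (L : ℝ) ^ (d + 1) * N₁ := by
    rw [modes_sum_split β H₀ (torusCosSum L)]
    simp only [torusCosSum, Finset.mul_sum, hN₁]
    rw [Finset.sum_comm]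
    refine Finset.sum_congr rfl fun i _ => ?_
    rw [← Finset.mul_sum, ← modes_weightedSumRule β H₀ i]
  have key := koma_kls_abstract Gq cq hβ hg (by positivity : (0 : ℝ) ≤ (L : ℝ) ^ (d + 1)) hG hc hIR hDC hSR
  linarith [key]

end KomaPiFlux

end Literature.MathematicalPhysics.QuantumLattice

end
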